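import Summits.PneNP.PneNP.Theses.ConvexRankGates
import Summits.PneNP.PneNP.Theorems.ConvexRankGatesCliqueExtLowerBoundConvCalibration
import Summits.PneNP.PneNP.Theorems.ConvexRankGatesCliqueExtLowerBoundRealGateLowerBound

/-!
# Calibration / bridge for the r6 CONV stub `stub_convWide` (crux `CliqueExtLowerBound`, stmt-PneNP-10682)

Line `width-threshold-certificate-sparsity`, reshape r6 (lead c2). The r6 CONV stub covers only CONV gates with
MORE THAN `⌊m^{1/16}⌋₊` rows AND psd dimension MORE THAN `c + 1`; the other CONV gates are FREE by the landed
real-gate engine (`RealGateLowerBound.fewRowsConv_statement`, `RealGateLowerBound.boundedDimConv_statement`).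
This file records, as LANDED implications (the stub text taken verbatim as a hypothesis):

* `convHighDim_r4_of_r6` — the r6 stub implies the r4 stub text (all CONV gates with `q ≥ 2`), hence everything
  c1's calibration derived from it;
* `convSandwichable_of_convWide` — ALL CONV gates of width `≤ m^c` are sandwichable;
* `convLowerBound_of_convWide` — the CONV-only lower bound at `δ = 1/4` (crux #2's schedule);
* `oneConvGate_blind_of_convWide` — NO single SDP-feasibility gate of width `m^c` computes `CLIQUE(m, ⌈m^{1/4}⌉₊)`
  (Oliveira–Pudlák's single-gate problem, psd form): the stub is at least that hard;
* `cliqueExtLowerBound_of_three_r6` (REGISTERED) — THE BRIDGE: the crux from the three r6 stub texts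
  `stub_permSandwichable`, `stub_grankSandwichable`, `stub_convWide`, everything else being landed.

Lead prover seat `prover-line-stmt-PneNP-10682-c2`, 2026-08-16.
-/

set_option linter.dupNamespace false

open Literature.Computability.Complexity Filter Finset
open Summit.PneNP.PneNP.Theorems.CliqueExtLowerBound.WidthThreshold

noncomputable section

namespace Summit.PneNP.PneNP.Theorems.CliqueExtLowerBound.WidthThreshold.ConvCalibrationR6

open Classical in
/-- **The r6 stub implies the r4 stub text** (all CONV gates of psd dimension `q ≥ 2` are sandwichable): split a
witness by `q ≤ c + 1` (bounded dimension, landed), else `p ≤ ⌊m^{1/16}⌋₊` (few rows, landed), else the r6 stub.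
[cite: Jukna2012, Thm. 9.21] -/
theorem convHighDim_r4_of_r6 :
    (∀ c : ℕ, ∃ r₀ s₀ : ℕ, 2 ≤ r₀ ∧ 2 ≤ s₀ ∧ ∀ r s : ℕ, r₀ ≤ r → s₀ ≤ s →
    ∀ᶠ m : ℕ in atTop, ∀ φ : GateFn,
      (∃ p q : ℕ, p + q ≤ m ^ c ∧ ⌊(m : ℝ) ^ (1 / 16 : ℝ)⌋₊ < p ∧ c + 1 < q ∧
        ∃ (A : Fin p → Matrix (Fin q) (Fin q) ℝ) (b : Fin p → ℝ)
        (B : Fin p → Fin φ.1 → ℝ), (∀ i j, 0 ≤ B i j) ∧ ∀ v : Fin φ.1 → Bool, φ.2 v = true ↔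
          ∃ Y : Matrix (Fin q) (Fin q) ℝ, Y.PosSemidef ∧
            ∀ i, (A i * Y).trace ≤ b i + ∑ j, B i j * (if v j then (1 : ℝ) else 0)) →
      ∀ (D C : Fin φ.1 → Finset (Finset ((⊤ : SimpleGraph (Fin m)).edgeSet))),
        #(univ.image fun j => (D j, C j)) ≤ m ^ (c + 3) →
        (∀ j, ∀ R ∈ D j, #R ≤ r - 1) → (∀ j, ∀ S ∈ C j, #S ≤ s - 1) →
        (∀ j x, EvalDNF (D j) x → EvalCNF (C j) x) →
        ∃ dnf cnf : Finset (Finset ((⊤ : SimpleGraph (Fin m)).edgeSet)),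
          (∀ R ∈ dnf, #R ≤ r - 1) ∧ (∀ S ∈ cnf, #S ≤ s - 1) ∧
          (∀ x, EvalDNF dnf x → EvalCNF cnf x) ∧
          (#((posGraphs m ⌈(m : ℝ) ^ (1 / 4 : ℝ)⌉₊).filter
              (fun x => φ.2 (fun j => decide (EvalDNF (D j) x)) = true ∧ ¬ EvalDNF dnf x)) : ℝ)
            ≤ (1 / (8 * (m : ℝ) ^ (c + 1))) * #(posGraphs m ⌈(m : ℝ) ^ (1 / 4 : ℝ)⌉₊) ∧
          (#((((powersetCard (Fintype.card ((⊤ : SimpleGraph (Fin m)).edgeSet) / ⌊(m : ℝ) ^ (1 / 8 : ℝ)⌋₊)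
          (univ : Finset ((⊤ : SimpleGraph (Fin m)).edgeSet))).image (fun M => fun e => decide (e ∉ M)))).filter
              (fun x => EvalCNF cnf x ∧ φ.2 (fun j => decide (EvalCNF (C j) x)) = false)) : ℝ)
            ≤ (1 / (8 * (m : ℝ) ^ (c + 1))) *
              #(((powersetCard (Fintype.card ((⊤ : SimpleGraph (Fin m)).edgeSet) / ⌊(m : ℝ) ^ (1 / 8 : ℝ)⌋₊)
          (univ : Finset ((⊤ : SimpleGraph (Fin m)).edgeSet))).image (fun M => fun e => decide (e ∉ M))))) →
    (∀ c : ℕ, ∃ r₀ s₀ : ℕ, 2 ≤ r₀ ∧ 2 ≤ s₀ ∧ ∀ r s : ℕ, r₀ ≤ r → s₀ ≤ s →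
      ∀ᶠ m : ℕ in atTop, ∀ φ : GateFn,
      (∃ p q : ℕ, p + q ≤ m ^ c ∧ 2 ≤ q ∧ ∃ (A : Fin p → Matrix (Fin q) (Fin q) ℝ) (b : Fin p → ℝ)
      (B : Fin p → Fin φ.1 → ℝ), (∀ i j, 0 ≤ B i j) ∧ ∀ v : Fin φ.1 → Bool, φ.2 v = true ↔
      ∃ Y : Matrix (Fin q) (Fin q) ℝ, Y.PosSemidef ∧
      ∀ i, (A i * Y).trace ≤ b i + ∑ j, B i j * (if v j then (1 : ℝ) else 0)) →
      ∀ (D C : Fin φ.1 → Finset (Finset ((⊤ : SimpleGraph (Fin m)).edgeSet))),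
      #(univ.image fun j => (D j, C j)) ≤ m ^ (c + 3) →
      (∀ j, ∀ R ∈ D j, #R ≤ r - 1) → (∀ j, ∀ S ∈ C j, #S ≤ s - 1) →
      (∀ j x, EvalDNF (D j) x → EvalCNF (C j) x) →
      ∃ dnf cnf : Finset (Finset ((⊤ : SimpleGraph (Fin m)).edgeSet)),
      (∀ R ∈ dnf, #R ≤ r - 1) ∧ (∀ S ∈ cnf, #S ≤ s - 1) ∧
      (∀ x, EvalDNF dnf x → EvalCNF cnf x) ∧
      (#((posGraphs m ⌈(m : ℝ) ^ (1 / 4 : ℝ)⌉₊).filter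
      (fun x => φ.2 (fun j => decide (EvalDNF (D j) x)) = true ∧ ¬ EvalDNF dnf x)) : ℝ)
      ≤ (1 / (8 * (m : ℝ) ^ (c + 1))) * #(posGraphs m ⌈(m : ℝ) ^ (1 / 4 : ℝ)⌉₊) ∧
      (#((((powersetCard (Fintype.card ((⊤ : SimpleGraph (Fin m)).edgeSet) / ⌊(m : ℝ) ^ (1 / 8 : ℝ)⌋₊)
      (univ : Finset ((⊤ : SimpleGraph (Fin m)).edgeSet))).image (fun M => fun e => decide (e ∉ M)))).filter
      (fun x => EvalCNF cnf x ∧ φ.2 (fun j => decide (EvalCNF (C j) x)) = false)) : ℝ)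
      ≤ (1 / (8 * (m : ℝ) ^ (c + 1))) *
      #(((powersetCard (Fintype.card ((⊤ : SimpleGraph (Fin m)).edgeSet) / ⌊(m : ℝ) ^ (1 / 8 : ℝ)⌋₊)
      (univ : Finset ((⊤ : SimpleGraph (Fin m)).edgeSet))).image (fun M => fun e => decide (e ∉ M))))) := by
  intro hW c
  obtain ⟨r₁, s₁, hr₁, hs₁, h₁⟩ := hW c
  obtain ⟨r₂, s₂, hr₂, hs₂, h₂⟩ := RealGateLowerBound.fewRowsConv_statement c
  obtain ⟨r₃, s₃, hr₃, hs₃, h₃⟩ := RealGateLowerBound.boundedDimConv_statement (c + 1) c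
  refine ⟨max r₁ (max r₂ r₃), max s₁ (max s₂ s₃), le_trans hr₁ (le_max_left _ _),
    le_trans hs₁ (le_max_left _ _), fun r s hr hs => ?_⟩
  filter_upwards [h₁ r s ((le_max_left _ _).trans hr) ((le_max_left _ _).trans hs),
    h₂ r s ((le_max_left _ _).trans ((le_max_right _ _).trans hr))
      ((le_max_left _ _).trans ((le_max_right _ _).trans hs)),
    h₃ r s ((le_max_right _ _).trans ((le_max_right _ _).trans hr))
      ((le_max_right _ _).trans ((le_max_right _ _).trans hs))] with m hm₁ hm₂ hm₃ φ hφ D C hA hD hC hDC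
  obtain ⟨p, q, hpq, -, A, b, B, hB, hrep⟩ := hφ
  by_cases hq : q ≤ c + 1
  · exact hm₃ φ ⟨p, q, hpq, hq, A, b, B, hB, hrep⟩ D C hA hD hC hDC
  · by_cases hp : p ≤ ⌊(m : ℝ) ^ (1 / 16 : ℝ)⌋₊
    · exact hm₂ φ ⟨p, q, hpq, hp, A, b, B, hB, hrep⟩ D C hA hD hC hDC
    · exact hm₁ φ ⟨p, q, hpq, not_le.1 hp, not_le.1 hq, A, b, B, hB, hrep⟩ D C hA hD hC hDC

open Classical in
/-- **All CONV gates of width `≤ m^c` are sandwichable under the r6 stub.** [cite: Jukna2012, Thm. 9.21] -/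
theorem convSandwichable_of_convWide :
    (∀ c : ℕ, ∃ r₀ s₀ : ℕ, 2 ≤ r₀ ∧ 2 ≤ s₀ ∧ ∀ r s : ℕ, r₀ ≤ r → s₀ ≤ s →
    ∀ᶠ m : ℕ in atTop, ∀ φ : GateFn,
      (∃ p q : ℕ, p + q ≤ m ^ c ∧ ⌊(m : ℝ) ^ (1 / 16 : ℝ)⌋₊ < p ∧ c + 1 < q ∧
        ∃ (A : Fin p → Matrix (Fin q) (Fin q) ℝ) (b : Fin p → ℝ)
        (B : Fin p → Fin φ.1 → ℝ), (∀ i j, 0 ≤ B i j) ∧ ∀ v : Fin φ.1 → Bool, φ.2 v = true ↔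
          ∃ Y : Matrix (Fin q) (Fin q) ℝ, Y.PosSemidef ∧
            ∀ i, (A i * Y).trace ≤ b i + ∑ j, B i j * (if v j then (1 : ℝ) else 0)) →
      ∀ (D C : Fin φ.1 → Finset (Finset ((⊤ : SimpleGraph (Fin m)).edgeSet))),
        #(univ.image fun j => (D j, C j)) ≤ m ^ (c + 3) →
        (∀ j, ∀ R ∈ D j, #R ≤ r - 1) → (∀ j, ∀ S ∈ C j, #S ≤ s - 1) →
        (∀ j x, EvalDNF (D j) x → EvalCNF (C j) x) →
        ∃ dnf cnf : Finset (Finset ((⊤ : SimpleGraph (Fin m)).edgeSet)),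
          (∀ R ∈ dnf, #R ≤ r - 1) ∧ (∀ S ∈ cnf, #S ≤ s - 1) ∧
          (∀ x, EvalDNF dnf x → EvalCNF cnf x) ∧
          (#((posGraphs m ⌈(m : ℝ) ^ (1 / 4 : ℝ)⌉₊).filter
              (fun x => φ.2 (fun j => decide (EvalDNF (D j) x)) = true ∧ ¬ EvalDNF dnf x)) : ℝ)
            ≤ (1 / (8 * (m : ℝ) ^ (c + 1))) * #(posGraphs m ⌈(m : ℝ) ^ (1 / 4 : ℝ)⌉₊) ∧
          (#((((powersetCard (Fintype.card ((⊤ : SimpleGraph (Fin m)).edgeSet) / ⌊(m : ℝ) ^ (1 / 8 : ℝ)⌋₊)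
          (univ : Finset ((⊤ : SimpleGraph (Fin m)).edgeSet))).image (fun M => fun e => decide (e ∉ M)))).filter
              (fun x => EvalCNF cnf x ∧ φ.2 (fun j => decide (EvalCNF (C j) x)) = false)) : ℝ)
            ≤ (1 / (8 * (m : ℝ) ^ (c + 1))) *
              #(((powersetCard (Fintype.card ((⊤ : SimpleGraph (Fin m)).edgeSet) / ⌊(m : ℝ) ^ (1 / 8 : ℝ)⌋₊)
          (univ : Finset ((⊤ : SimpleGraph (Fin m)).edgeSet))).image (fun M => fun e => decide (e ∉ M))))) →
    ∀ c : ℕ, ∃ r₀ s₀ : ℕ, 2 ≤ r₀ ∧ 2 ≤ s₀ ∧ ∀ r s : ℕ, r₀ ≤ r → s₀ ≤ s →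
      ∀ᶠ m : ℕ in atTop, ∀ φ : GateFn, IsConvGate (m ^ c) φ →
        Sandwichable r s (m ^ (c + 3)) (posFam m) (negFam m) (eps m c) φ :=
  fun hW => ConvCalibration.convSandwichable_of_convHighDim (convHighDim_r4_of_r6 hW)

open Classical in
/-- **The r6 stub implies the CONV-only lower bound at `δ = 1/4`.** [cite: Jukna2012, Thm. 9.21] -/
theorem convLowerBound_of_convWide :
    (∀ c : ℕ, ∃ r₀ s₀ : ℕ, 2 ≤ r₀ ∧ 2 ≤ s₀ ∧ ∀ r s : ℕ, r₀ ≤ r → s₀ ≤ s →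
    ∀ᶠ m : ℕ in atTop, ∀ φ : GateFn,
      (∃ p q : ℕ, p + q ≤ m ^ c ∧ ⌊(m : ℝ) ^ (1 / 16 : ℝ)⌋₊ < p ∧ c + 1 < q ∧
        ∃ (A : Fin p → Matrix (Fin q) (Fin q) ℝ) (b : Fin p → ℝ)
        (B : Fin p → Fin φ.1 → ℝ), (∀ i j, 0 ≤ B i j) ∧ ∀ v : Fin φ.1 → Bool, φ.2 v = true ↔
          ∃ Y : Matrix (Fin q) (Fin q) ℝ, Y.PosSemidef ∧
            ∀ i, (A i * Y).trace ≤ b i + ∑ j, B i j * (if v j then (1 : ℝ) else 0)) →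
      ∀ (D C : Fin φ.1 → Finset (Finset ((⊤ : SimpleGraph (Fin m)).edgeSet))),
        #(univ.image fun j => (D j, C j)) ≤ m ^ (c + 3) →
        (∀ j, ∀ R ∈ D j, #R ≤ r - 1) → (∀ j, ∀ S ∈ C j, #S ≤ s - 1) →
        (∀ j x, EvalDNF (D j) x → EvalCNF (C j) x) →
        ∃ dnf cnf : Finset (Finset ((⊤ : SimpleGraph (Fin m)).edgeSet)),
          (∀ R ∈ dnf, #R ≤ r - 1) ∧ (∀ S ∈ cnf, #S ≤ s - 1) ∧
          (∀ x, EvalDNF dnf x → EvalCNF cnf x) ∧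
          (#((posGraphs m ⌈(m : ℝ) ^ (1 / 4 : ℝ)⌉₊).filter
              (fun x => φ.2 (fun j => decide (EvalDNF (D j) x)) = true ∧ ¬ EvalDNF dnf x)) : ℝ)
            ≤ (1 / (8 * (m : ℝ) ^ (c + 1))) * #(posGraphs m ⌈(m : ℝ) ^ (1 / 4 : ℝ)⌉₊) ∧
          (#((((powersetCard (Fintype.card ((⊤ : SimpleGraph (Fin m)).edgeSet) / ⌊(m : ℝ) ^ (1 / 8 : ℝ)⌋₊)
          (univ : Finset ((⊤ : SimpleGraph (Fin m)).edgeSet))).image (fun M => fun e => decide (e ∉ M)))).filter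
              (fun x => EvalCNF cnf x ∧ φ.2 (fun j => decide (EvalCNF (C j) x)) = false)) : ℝ)
            ≤ (1 / (8 * (m : ℝ) ^ (c + 1))) *
              #(((powersetCard (Fintype.card ((⊤ : SimpleGraph (Fin m)).edgeSet) / ⌊(m : ℝ) ^ (1 / 8 : ℝ)⌋₊)
          (univ : Finset ((⊤ : SimpleGraph (Fin m)).edgeSet))).image (fun M => fun e => decide (e ∉ M))))) →
    ∀ c : ℕ, ∀ᶠ m : ℕ in atTop, ∀ C : Circuit ((⊤ : SimpleGraph (Fin m)).edgeSet),
      C.IsOver ({GateFn.and 2, GateFn.or 2} ∪ {g | IsConvGate (m ^ c) g}) →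
        C.size ≤ m ^ c → ¬ C.Computes (cliqueFn m ⌈(m : ℝ) ^ (1 / 4 : ℝ)⌉₊) :=
  fun hW => ConvCalibration.convLowerBound_of_convSandwichable (convSandwichable_of_convWide hW)

open Classical in
/-- **The r6 stub forbids ONE SDP-feasibility gate** of width `m^c` for `CLIQUE(m, ⌈m^{1/4}⌉₊)` (any wiring of its
inputs to edges): Oliveira–Pudlák's single-gate problem in psd form is a consequence. [cite: OliveiraPudlak2019, Def. 3.1] -/
theorem oneConvGate_blind_of_convWide :
    (∀ c : ℕ, ∃ r₀ s₀ : ℕ, 2 ≤ r₀ ∧ 2 ≤ s₀ ∧ ∀ r s : ℕ, r₀ ≤ r → s₀ ≤ s →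
    ∀ᶠ m : ℕ in atTop, ∀ φ : GateFn,
      (∃ p q : ℕ, p + q ≤ m ^ c ∧ ⌊(m : ℝ) ^ (1 / 16 : ℝ)⌋₊ < p ∧ c + 1 < q ∧
        ∃ (A : Fin p → Matrix (Fin q) (Fin q) ℝ) (b : Fin p → ℝ)
        (B : Fin p → Fin φ.1 → ℝ), (∀ i j, 0 ≤ B i j) ∧ ∀ v : Fin φ.1 → Bool, φ.2 v = true ↔
          ∃ Y : Matrix (Fin q) (Fin q) ℝ, Y.PosSemidef ∧
            ∀ i, (A i * Y).trace ≤ b i + ∑ j, B i j * (if v j then (1 : ℝ) else 0)) →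
      ∀ (D C : Fin φ.1 → Finset (Finset ((⊤ : SimpleGraph (Fin m)).edgeSet))),
        #(univ.image fun j => (D j, C j)) ≤ m ^ (c + 3) →
        (∀ j, ∀ R ∈ D j, #R ≤ r - 1) → (∀ j, ∀ S ∈ C j, #S ≤ s - 1) →
        (∀ j x, EvalDNF (D j) x → EvalCNF (C j) x) →
        ∃ dnf cnf : Finset (Finset ((⊤ : SimpleGraph (Fin m)).edgeSet)),
          (∀ R ∈ dnf, #R ≤ r - 1) ∧ (∀ S ∈ cnf, #S ≤ s - 1) ∧
          (∀ x, EvalDNF dnf x → EvalCNF cnf x) ∧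
          (#((posGraphs m ⌈(m : ℝ) ^ (1 / 4 : ℝ)⌉₊).filter
              (fun x => φ.2 (fun j => decide (EvalDNF (D j) x)) = true ∧ ¬ EvalDNF dnf x)) : ℝ)
            ≤ (1 / (8 * (m : ℝ) ^ (c + 1))) * #(posGraphs m ⌈(m : ℝ) ^ (1 / 4 : ℝ)⌉₊) ∧
          (#((((powersetCard (Fintype.card ((⊤ : SimpleGraph (Fin m)).edgeSet) / ⌊(m : ℝ) ^ (1 / 8 : ℝ)⌋₊)
          (univ : Finset ((⊤ : SimpleGraph (Fin m)).edgeSet))).image (fun M => fun e => decide (e ∉ M)))).filter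
              (fun x => EvalCNF cnf x ∧ φ.2 (fun j => decide (EvalCNF (C j) x)) = false)) : ℝ)
            ≤ (1 / (8 * (m : ℝ) ^ (c + 1))) *
              #(((powersetCard (Fintype.card ((⊤ : SimpleGraph (Fin m)).edgeSet) / ⌊(m : ℝ) ^ (1 / 8 : ℝ)⌋₊)
          (univ : Finset ((⊤ : SimpleGraph (Fin m)).edgeSet))).image (fun M => fun e => decide (e ∉ M))))) →
    ∀ c : ℕ, ∀ᶠ m : ℕ in atTop,
      ∀ (n : ℕ) (f : (Fin n → Bool) → Bool) (w : Fin n → (⊤ : SimpleGraph (Fin m)).edgeSet),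
        IsConvGate (m ^ c) ⟨n, f⟩ →
        ¬ ∀ x : (⊤ : SimpleGraph (Fin m)).edgeSet → Bool,
          f (fun i => x (w i)) = cliqueFn m ⌈(m : ℝ) ^ (1 / 4 : ℝ)⌉₊ x :=
  fun hW => ConvCalibration.oneConvGate_blind_of_convLowerBound (convLowerBound_of_convWide hW)

open Classical in
/-- **THE BRIDGE (r6, REGISTERED `cliqueExtLowerBound_of_three_r6`)**: the crux from the three open r6 stub texts
`stub_permSandwichable`, `stub_grankSandwichable`, `stub_convWide` — everything else of the line is landed
(engine p77958, referee p80267, inline p81583, narrow algebraic p81373, reduction p109122, real-gate engine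
p120197/p119986/p120019/p120293/p120473/p120634). [cite: Jukna2012, Thm. 9.21] -/
theorem cliqueExtLowerBound_of_three_r6 :
    (∀ c : ℕ, ∃ r₀ s₀ : ℕ, 2 ≤ r₀ ∧ 2 ≤ s₀ ∧ ∀ r s : ℕ, r₀ ≤ r → s₀ ≤ s →
    ∀ᶠ m : ℕ in atTop, ∀ φ : GateFn, IsPermGate (m ^ c) φ →
      ¬ (IsPermGate ⌊(m : ℝ) ^ (1 / 16 : ℝ)⌋₊ φ ∨ IsGRankGate ⌊(m : ℝ) ^ (1 / 16 : ℝ)⌋₊ φ) →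
      ∀ (D C : Fin φ.1 → Finset (Finset ((⊤ : SimpleGraph (Fin m)).edgeSet))),
        #(univ.image fun j => (D j, C j)) ≤ m ^ (c + 3) →
        (∀ j, ∀ R ∈ D j, #R ≤ r - 1) → (∀ j, ∀ S ∈ C j, #S ≤ s - 1) →
        (∀ j x, EvalDNF (D j) x → EvalCNF (C j) x) →
        ∃ dnf cnf : Finset (Finset ((⊤ : SimpleGraph (Fin m)).edgeSet)),
          (∀ R ∈ dnf, #R ≤ r - 1) ∧ (∀ S ∈ cnf, #S ≤ s - 1) ∧
          (∀ x, EvalDNF dnf x → EvalCNF cnf x) ∧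
          (#((posGraphs m ⌈(m : ℝ) ^ (1 / 4 : ℝ)⌉₊).filter
              (fun x => φ.2 (fun j => decide (EvalDNF (D j) x)) = true ∧ ¬ EvalDNF dnf x)) : ℝ)
            ≤ (1 / (8 * (m : ℝ) ^ (c + 1))) * #(posGraphs m ⌈(m : ℝ) ^ (1 / 4 : ℝ)⌉₊) ∧
          (#((((powersetCard (Fintype.card ((⊤ : SimpleGraph (Fin m)).edgeSet) / ⌊(m : ℝ) ^ (1 / 8 : ℝ)⌋₊)
          (univ : Finset ((⊤ : SimpleGraph (Fin m)).edgeSet))).image (fun M => fun e => decide (e ∉ M)))).filter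
              (fun x => EvalCNF cnf x ∧ φ.2 (fun j => decide (EvalCNF (C j) x)) = false)) : ℝ)
            ≤ (1 / (8 * (m : ℝ) ^ (c + 1))) *
              #(((powersetCard (Fintype.card ((⊤ : SimpleGraph (Fin m)).edgeSet) / ⌊(m : ℝ) ^ (1 / 8 : ℝ)⌋₊)
          (univ : Finset ((⊤ : SimpleGraph (Fin m)).edgeSet))).image (fun M => fun e => decide (e ∉ M))))) →
    (∀ c : ℕ, ∃ r₀ s₀ : ℕ, 2 ≤ r₀ ∧ 2 ≤ s₀ ∧ ∀ r s : ℕ, r₀ ≤ r → s₀ ≤ s →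
    ∀ᶠ m : ℕ in atTop, ∀ φ : GateFn, IsGRankGate (m ^ c) φ →
      ¬ (IsPermGate ⌊(m : ℝ) ^ (1 / 16 : ℝ)⌋₊ φ ∨ IsGRankGate ⌊(m : ℝ) ^ (1 / 16 : ℝ)⌋₊ φ) →
      ∀ (D C : Fin φ.1 → Finset (Finset ((⊤ : SimpleGraph (Fin m)).edgeSet))),
        #(univ.image fun j => (D j, C j)) ≤ m ^ (c + 3) →
        (∀ j, ∀ R ∈ D j, #R ≤ r - 1) → (∀ j, ∀ S ∈ C j, #S ≤ s - 1) →
        (∀ j x, EvalDNF (D j) x → EvalCNF (C j) x) →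
        ∃ dnf cnf : Finset (Finset ((⊤ : SimpleGraph (Fin m)).edgeSet)),
          (∀ R ∈ dnf, #R ≤ r - 1) ∧ (∀ S ∈ cnf, #S ≤ s - 1) ∧
          (∀ x, EvalDNF dnf x → EvalCNF cnf x) ∧
          (#((posGraphs m ⌈(m : ℝ) ^ (1 / 4 : ℝ)⌉₊).filter
              (fun x => φ.2 (fun j => decide (EvalDNF (D j) x)) = true ∧ ¬ EvalDNF dnf x)) : ℝ)
            ≤ (1 / (8 * (m : ℝ) ^ (c + 1))) * #(posGraphs m ⌈(m : ℝ) ^ (1 / 4 : ℝ)⌉₊) ∧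
          (#((((powersetCard (Fintype.card ((⊤ : SimpleGraph (Fin m)).edgeSet) / ⌊(m : ℝ) ^ (1 / 8 : ℝ)⌋₊)
          (univ : Finset ((⊤ : SimpleGraph (Fin m)).edgeSet))).image (fun M => fun e => decide (e ∉ M)))).filter
              (fun x => EvalCNF cnf x ∧ φ.2 (fun j => decide (EvalCNF (C j) x)) = false)) : ℝ)
            ≤ (1 / (8 * (m : ℝ) ^ (c + 1))) *
              #(((powersetCard (Fintype.card ((⊤ : SimpleGraph (Fin m)).edgeSet) / ⌊(m : ℝ) ^ (1 / 8 : ℝ)⌋₊)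
          (univ : Finset ((⊤ : SimpleGraph (Fin m)).edgeSet))).image (fun M => fun e => decide (e ∉ M))))) →
    (∀ c : ℕ, ∃ r₀ s₀ : ℕ, 2 ≤ r₀ ∧ 2 ≤ s₀ ∧ ∀ r s : ℕ, r₀ ≤ r → s₀ ≤ s →
    ∀ᶠ m : ℕ in atTop, ∀ φ : GateFn,
      (∃ p q : ℕ, p + q ≤ m ^ c ∧ ⌊(m : ℝ) ^ (1 / 16 : ℝ)⌋₊ < p ∧ c + 1 < q ∧
        ∃ (A : Fin p → Matrix (Fin q) (Fin q) ℝ) (b : Fin p → ℝ)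
        (B : Fin p → Fin φ.1 → ℝ), (∀ i j, 0 ≤ B i j) ∧ ∀ v : Fin φ.1 → Bool, φ.2 v = true ↔
          ∃ Y : Matrix (Fin q) (Fin q) ℝ, Y.PosSemidef ∧
            ∀ i, (A i * Y).trace ≤ b i + ∑ j, B i j * (if v j then (1 : ℝ) else 0)) →
      ∀ (D C : Fin φ.1 → Finset (Finset ((⊤ : SimpleGraph (Fin m)).edgeSet))),
        #(univ.image fun j => (D j, C j)) ≤ m ^ (c + 3) →
        (∀ j, ∀ R ∈ D j, #R ≤ r - 1) → (∀ j, ∀ S ∈ C j, #S ≤ s - 1) →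
        (∀ j x, EvalDNF (D j) x → EvalCNF (C j) x) →
        ∃ dnf cnf : Finset (Finset ((⊤ : SimpleGraph (Fin m)).edgeSet)),
          (∀ R ∈ dnf, #R ≤ r - 1) ∧ (∀ S ∈ cnf, #S ≤ s - 1) ∧
          (∀ x, EvalDNF dnf x → EvalCNF cnf x) ∧
          (#((posGraphs m ⌈(m : ℝ) ^ (1 / 4 : ℝ)⌉₊).filter
              (fun x => φ.2 (fun j => decide (EvalDNF (D j) x)) = true ∧ ¬ EvalDNF dnf x)) : ℝ)
            ≤ (1 / (8 * (m : ℝ) ^ (c + 1))) * #(posGraphs m ⌈(m : ℝ) ^ (1 / 4 : ℝ)⌉₊) ∧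
          (#((((powersetCard (Fintype.card ((⊤ : SimpleGraph (Fin m)).edgeSet) / ⌊(m : ℝ) ^ (1 / 8 : ℝ)⌋₊)
          (univ : Finset ((⊤ : SimpleGraph (Fin m)).edgeSet))).image (fun M => fun e => decide (e ∉ M)))).filter
              (fun x => EvalCNF cnf x ∧ φ.2 (fun j => decide (EvalCNF (C j) x)) = false)) : ℝ)
            ≤ (1 / (8 * (m : ℝ) ^ (c + 1))) *
              #(((powersetCard (Fintype.card ((⊤ : SimpleGraph (Fin m)).edgeSet) / ⌊(m : ℝ) ^ (1 / 8 : ℝ)⌋₊)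
          (univ : Finset ((⊤ : SimpleGraph (Fin m)).edgeSet))).image (fun M => fun e => decide (e ∉ M))))) →
    Summit.PneNP.PneNP.Theses.ConvexRankGates.CliqueExtLowerBound :=
  fun hP hG hW => ConvCalibration.cliqueExtLowerBound_of_three hP hG (convHighDim_r4_of_r6 hW)

end Summit.PneNP.PneNP.Theorems.CliqueExtLowerBound.WidthThreshold.ConvCalibrationR6

end
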